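import Summits.Ventures.Crystal3D.TopCut.X2D8u060AggR1

/-!
# X2 cap cut `X2D8u060` (u₀ = -3/5, degrees (d, d_X) = (8, 8)): re-split kernel validation of Gram blocks R3 (okR3k_1, okR3k_2; cost proxies [0.039, 0.032] Gbit)

HONEST FRAMING: generated data / kernel-validation file of the venture `Crystal3D` (cell `pub-crystal3d`, phase 2, seat p2):
RE-SPLIT Gram-chunk validations of the exact SOS-form X2 certificate of this namespace into chunks small enough to
re-elaborate on standard farm nodes (referee replay; lead RULING #97). The Gram data (`g<blk>K`, `e<blk>`) are the landed ones;
only new partial row sums and small `decide +kernel` chunk checks are added. Nothing geometric is proved in this file;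
standard axioms only, no `native_decide`.
-/

namespace Summit.Ventures.Crystal3D.TopCut.X2D8u060

open Literature.Geometry.DiscreteGeometry Literature.Geometry.DiscreteGeometry.PolyCert PolyCert.SPoly
open Literature.Geometry.DiscreteGeometry.BachocVallentin
open Summit.Ventures.PackingBounds.ThreePointCert Summit.Ventures.Crystal3D.CapSOS Summit.Ventures.Crystal3D.CapX2 Summit.Ventures.Crystal3D.X2SOS

set_option maxRecDepth 100000 in
set_option maxHeartbeats 0 in
/-- Block `R3` (re-split): rows from 0 (53 rows) of `zᵀ(LLᵀ)z` added to `[]` give `dR3k1`; cost proxy 0.039 Gbit. [folklore] -/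
theorem okR3k_1 : chunkOKK X2D8u060.gR3K 0 53 [] X2D8u060.dR3k1 = true := by
  decide +kernel

set_option maxRecDepth 100000 in
set_option maxHeartbeats 0 in
/-- Block `R3` (re-split): rows from 53 ((X2D8u060.gR3K.z.length - 53) rows) of `zᵀ(LLᵀ)z` added to `dR3k1` give `eR3`; cost proxy 0.032 Gbit. [folklore] -/
theorem okR3k_2 : chunkOKK X2D8u060.gR3K 53 (X2D8u060.gR3K.z.length - 53) X2D8u060.dR3k1 X2D8u060.eR3 = true := by
  decide +kernel

end Summit.Ventures.Crystal3D.TopCut.X2D8u060
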